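import Summits.Ventures.PackingBounds.ThreePointCert.CheckKron
import Summits.Ventures.PackingBounds.ThreePointCert.T15d11LeafF1
import Summits.Ventures.PackingBounds.ThreePointCert.T15d11LeafF2
import Summits.Ventures.PackingBounds.ThreePointCert.T15d11LeafF3
import Summits.Ventures.PackingBounds.ThreePointCert.T15d11Agg1

/-!
# Tammes θ(15) ≤ arccos(717/1250) = 54.9984° (A(3, 0.5736) ≤ 14): aggregates, part 1 (Gram blocks, decoded polynomials, certificate records)

Framing: lottery ticket; floor = certified bounds/negative ranges. Venture `PackingBounds` (cell
`pub-packcert`), three-point SDP family. Integer data of a feasible point of the Bachoc–Vallentin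
semidefinite program (n = 3, s = 717/1250, degree d = 11, Bachoc–Vallentin
multiplier set = cell mode sym2), derived by `cert2lean_s2.py` (sdp gen 5 fork of cert2lean_lp.py) from the exact rational certificate
`sdp-n3-d11-s717-1250-sym2f-lpclient-v1.json` of the cell (exact verifier #1 + verifier #2 of the other seat), in the units of the kernel
checker `ThreePointCert.Check` + `CheckSym2` (soundness `card_le_of_cert3S2`); Gram factors offset-encoded for the
Kronecker-packed chunk validation `ThreePointCert.CheckKron` (emitter `emitleanS2.py` = lp gen 3 emitleanK.py). Generated file: plain
lists of integers / monomials.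
-/

namespace Summit.Ventures.PackingBounds.ThreePointCert.T15d11

open Literature.Geometry.DiscreteGeometry Literature.Geometry.DiscreteGeometry.PolyCert PolyCert.SPoly

/-- Partial sum of `FI` over blocks k ≤ 0 (decoded term list). -/
def dFc1 : SPoly := ofFlat dFc1f0 ++ ofFlat dFc1f1

/-- Partial sum of `FI` over blocks k ≤ 1 (decoded term list). -/
def dFc2 : SPoly := ofFlat dFc2f0 ++ ofFlat dFc2f1 ++ ofFlat dFc2f2 ++ ofFlat dFc2f3

/-- Partial sum of `FI` over blocks k ≤ 2 (decoded term list). -/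
def dFc3 : SPoly := ofFlat dFc3f0 ++ ofFlat dFc3f1 ++ ofFlat dFc3f2 ++ ofFlat dFc3f3 ++ ofFlat dFc3f4

/-- Partial sum of `FI` over blocks k ≤ 3 (decoded term list). -/
def dFc4 : SPoly := ofFlat dFc4f0 ++ ofFlat dFc4f1 ++ ofFlat dFc4f2 ++ ofFlat dFc4f3 ++ ofFlat dFc4f4

/-- Partial sum of `FI` over blocks k ≤ 4 (decoded term list). -/
def dFc5 : SPoly := ofFlat dFc5f0 ++ ofFlat dFc5f1 ++ ofFlat dFc5f2 ++ ofFlat dFc5f3 ++ ofFlat dFc5f4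

/-- Partial sum of `FI` over blocks k ≤ 5 (decoded term list). -/
def dFc6 : SPoly := ofFlat dFc6f0 ++ ofFlat dFc6f1 ++ ofFlat dFc6f2 ++ ofFlat dFc6f3 ++ ofFlat dFc6f4

/-- Partial sum of `FI` over blocks k ≤ 6 (decoded term list). -/
def dFc7 : SPoly := ofFlat dFc7f0 ++ ofFlat dFc7f1 ++ ofFlat dFc7f2 ++ ofFlat dFc7f3 ++ ofFlat dFc7f4

/-- Partial sum of `FI` over blocks k ≤ 7 (decoded term list). -/
def dFc8 : SPoly := ofFlat dFc8f0 ++ ofFlat dFc8f1 ++ ofFlat dFc8f2 ++ ofFlat dFc8f3 ++ ofFlat dFc8f4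

/-- Partial sum of `FI` over blocks k ≤ 8 (decoded term list). -/
def dFc9 : SPoly := ofFlat dFc9f0 ++ ofFlat dFc9f1 ++ ofFlat dFc9f2 ++ ofFlat dFc9f3 ++ ofFlat dFc9f4

/-- Partial sum of `FI` over blocks k ≤ 10 (decoded term list). -/
def dFc10 : SPoly := ofFlat dFc10f0 ++ ofFlat dFc10f1 ++ ofFlat dFc10f2 ++ ofFlat dFc10f3 ++ ofFlat dFc10f4

end Summit.Ventures.PackingBounds.ThreePointCert.T15d11
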